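import Summits.CriticalPhenomena.PercolationContinuityZ3.Theorems.PercNearOneGluingNoHeavyLowerTailFrontierDecRowsEdgeInduction
import HarnessLib

/-!
# The increasing star from the ASYMMETRIC three-point forms `C5(A;B,C)` (Sahi programme, prover prim-sahi-p2 gen 40)

Support file (`--supports stmt-CriticalPhenomena-4575`).  No definitions, no named facts, no sorries; standard axioms.
Memo `run/shared/lean/prim/prim-sahi/FROM-prim-sahi-p2-gen40-C5-LIGHT-INDUCTION.md`, `prim-sahi-p2/PROOF-E3.md` §50.

For a probability law `μ` and three events `A, B, C` put (written out in full everywhere below, no definition is introduced)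

  `C5(μ; A; B, C) := 2 μ(A∩B∩C) + μ(A) μ(B) μ(C) − μ(A) μ(B∩C) − 2 μ(B) μ(A∩C)`.

* `c5_add_c5_swap` — `C5(μ;A;B,C) + C5(μ;A;C,B) = 2·E₃(A,B,C)` (Sahi's third-order functional `sahiE3`): the increasing star is the
  SUM of two asymmetric forms, and `C5(μ;A;B,C) = E₃ + μ(C)μ(A∩B) − μ(B)μ(A∩C)` (`c5_eq_sahiE3_add`).
* `sahiE3_nonneg_of_c5`, `abs_le_sahiE3_of_c5` — if both `C5(A;B,C) ≥ 0` and `C5(A;C,B) ≥ 0` then `E₃ ≥ |μ(B)μ(A∩C) − μ(C)μ(A∩B)| ≥ 0`.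
* `c5_oneBond` — along one pair `e` of a finite weighted graph the form is a Bernstein cubic in `p = w e`:
  `C5(P_w) = (1−p)³ C5(P⁰) + p(1−p)² M(P⁰,P¹) + p²(1−p) M(P¹,P⁰) + p³ C5(P¹)`, `P⁰ = P_{w[e↦0]}`, `P¹ = P_{w[e↦1]}`, with the mixed
  coefficient `M(μ,ν) = 3β` written out (`tree: stub_oneBondDecomp_k15`); `c5_nonneg_of_bernstein` — the four coefficients `≥ 0` give `C5(P_w) ≥ 0`.
* `c5_root_eq` — degenerate marking `A = univ` (target = root): `C5 = μ(B∩C) − μ(B)μ(C)`.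

CONTEXT (memo §1–§3): for the star events `A = {s↔a}, B = {s↔b}, C = {s↔c}` of bond percolation the cell conjectures
`C5(a;b,c) ≥ 0` for every ordering (equivalently `E₃ ≥ |q_b q_ac − q_c q_ab|`; law level 0 violations in ≈ 6 000 exact/float instances
n ≤ 8 incl. thin corners; per three-copy fibre on all 4 096 K₄ profiles) are Harris-LIGHT along every pair at the distinguished target `a`
that joins `a` to the root or to another target (exact LP certificates, kit j321143 / j321289; Lean replay in the companion files
`…IncStarC5RootTargetStep`, `…IncStarC5TargetTargetStep`); nothing in this file asserts those conjectures.
-/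

noncomputable section

namespace Summit.CriticalPhenomena.PercolationContinuityZ3.Theorems

namespace IncStar

open MeasureTheory Set Literature.Probability.Percolation Literature.Probability.LatticeModels EdgeInduction
open scoped Classical

variable {n : ℕ}

/-- `C5(μ;A;B,C) + C5(μ;A;C,B) = 2·E₃(A,B,C)`: Sahi's three-point functional is the sum of the two asymmetric forms. [this work] -/
theorem c5_add_c5_swap {Ω : Type*} [MeasurableSpace Ω] (μ : Measure Ω) (A B C : Set Ω) :
    (2 * μ.real (A ∩ B ∩ C) + μ.real A * μ.real B * μ.real C - μ.real A * μ.real (B ∩ C) - 2 * (μ.real B * μ.real (A ∩ C))) +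
      (2 * μ.real (A ∩ C ∩ B) + μ.real A * μ.real C * μ.real B - μ.real A * μ.real (C ∩ B) - 2 * (μ.real C * μ.real (A ∩ B))) =
      2 * sahiE3 μ A B C := by
  rw [sahiE3_def, Set.inter_comm C B, Set.inter_right_comm A C B]
  ring

/-- `C5(μ;A;B,C) = E₃(A,B,C) + μ(C)μ(A∩B) − μ(B)μ(A∩C)`. [this work] -/
theorem c5_eq_sahiE3_add {Ω : Type*} [MeasurableSpace Ω] (μ : Measure Ω) (A B C : Set Ω) :
    2 * μ.real (A ∩ B ∩ C) + μ.real A * μ.real B * μ.real C - μ.real A * μ.real (B ∩ C) - 2 * (μ.real B * μ.real (A ∩ C)) =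
      sahiE3 μ A B C + (μ.real C * μ.real (A ∩ B) - μ.real B * μ.real (A ∩ C)) := by
  rw [sahiE3_def]; ring

/-- **The increasing star from the two asymmetric forms**: `C5(A;B,C) ≥ 0` and `C5(A;C,B) ≥ 0` give `E₃(A,B,C) ≥ 0`. [this work] -/
theorem sahiE3_nonneg_of_c5 {Ω : Type*} [MeasurableSpace Ω] (μ : Measure Ω) (A B C : Set Ω)
    (h₁ : 0 ≤ 2 * μ.real (A ∩ B ∩ C) + μ.real A * μ.real B * μ.real C - μ.real A * μ.real (B ∩ C) - 2 * (μ.real B * μ.real (A ∩ C)))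
    (h₂ : 0 ≤ 2 * μ.real (A ∩ C ∩ B) + μ.real A * μ.real C * μ.real B - μ.real A * μ.real (C ∩ B) - 2 * (μ.real C * μ.real (A ∩ B))) :
    0 ≤ sahiE3 μ A B C := by
  have h := c5_add_c5_swap μ A B C
  linarith

/-- **Quantitative form**: the two asymmetric forms bound `E₃` below by the asymmetry `|μ(B)μ(A∩C) − μ(C)μ(A∩B)|`. [this work] -/
theorem abs_le_sahiE3_of_c5 {Ω : Type*} [MeasurableSpace Ω] (μ : Measure Ω) (A B C : Set Ω)
    (h₁ : 0 ≤ 2 * μ.real (A ∩ B ∩ C) + μ.real A * μ.real B * μ.real C - μ.real A * μ.real (B ∩ C) - 2 * (μ.real B * μ.real (A ∩ C)))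
    (h₂ : 0 ≤ 2 * μ.real (A ∩ C ∩ B) + μ.real A * μ.real C * μ.real B - μ.real A * μ.real (C ∩ B) - 2 * (μ.real C * μ.real (A ∩ B))) :
    |μ.real B * μ.real (A ∩ C) - μ.real C * μ.real (A ∩ B)| ≤ sahiE3 μ A B C := by
  have e₁ := c5_eq_sahiE3_add μ A B C
  have e₂ := c5_eq_sahiE3_add μ A C B
  rw [Set.inter_comm C B, Set.inter_right_comm A C B] at e₂ h₂
  have hs : sahiE3 μ A C B = sahiE3 μ A B C := by
    rw [sahiE3_def, sahiE3_def, Set.inter_comm C B, Set.inter_right_comm A C B]; ring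
  rw [abs_le]
  constructor <;> linarith [h₁, h₂, e₁, e₂, hs]

/-- Degenerate marking `A = univ` (the distinguished target IS the root): the asymmetric form is a covariance. [this work] -/
theorem c5_root_eq {Ω : Type*} [MeasurableSpace Ω] (μ : Measure Ω) [IsProbabilityMeasure μ] (B C : Set Ω) :
    2 * μ.real (Set.univ ∩ B ∩ C) + μ.real Set.univ * μ.real B * μ.real C - μ.real Set.univ * μ.real (B ∩ C)
        - 2 * (μ.real B * μ.real (Set.univ ∩ C)) = μ.real (B ∩ C) - μ.real B * μ.real C := by
  rw [Set.univ_inter, Set.univ_inter, probReal_univ]; ring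

/-- **`C5` along one pair is a Bernstein cubic** in `p = w e` with extreme coefficients the forms under `w[e↦0]`, `w[e↦1]` and the displayed
mixed coefficients (each is three times a Bernstein coefficient). [this work] -/
theorem c5_oneBond (w : Sym2 (Fin n) → unitInterval) (e : Sym2 (Fin n)) (A B C : Set (BondConfig (Fin n))) :
    let μ := prodBernoulli (Function.update w e 0)
    let ν := prodBernoulli (Function.update w e 1)
    2 * (prodBernoulli w).real (A ∩ B ∩ C) + (prodBernoulli w).real A * (prodBernoulli w).real B * (prodBernoulli w).real C
        - (prodBernoulli w).real A * (prodBernoulli w).real (B ∩ C) - 2 * ((prodBernoulli w).real B * (prodBernoulli w).real (A ∩ C)) =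
      (1 - (w e : ℝ)) ^ 3 * (2 * μ.real (A ∩ B ∩ C) + μ.real A * μ.real B * μ.real C - μ.real A * μ.real (B ∩ C) - 2 * (μ.real B * μ.real (A ∩ C)))
      + (w e : ℝ) * (1 - (w e : ℝ)) ^ 2 *
          (2 * (ν.real (A ∩ B ∩ C) + 2 * μ.real (A ∩ B ∩ C))
            + (ν.real A * μ.real B * μ.real C + μ.real A * ν.real B * μ.real C + μ.real A * μ.real B * ν.real C)
            - (ν.real A * μ.real (B ∩ C) + μ.real A * ν.real (B ∩ C) + μ.real A * μ.real (B ∩ C))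
            - 2 * (ν.real B * μ.real (A ∩ C) + μ.real B * ν.real (A ∩ C) + μ.real B * μ.real (A ∩ C)))
      + (w e : ℝ) ^ 2 * (1 - (w e : ℝ)) *
          (2 * (μ.real (A ∩ B ∩ C) + 2 * ν.real (A ∩ B ∩ C))
            + (μ.real A * ν.real B * ν.real C + ν.real A * μ.real B * ν.real C + ν.real A * ν.real B * μ.real C)
            - (μ.real A * ν.real (B ∩ C) + ν.real A * μ.real (B ∩ C) + ν.real A * ν.real (B ∩ C))
            - 2 * (μ.real B * ν.real (A ∩ C) + ν.real B * μ.real (A ∩ C) + ν.real B * ν.real (A ∩ C)))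
      + (w e : ℝ) ^ 3 * (2 * ν.real (A ∩ B ∩ C) + ν.real A * ν.real B * ν.real C - ν.real A * ν.real (B ∩ C) - 2 * (ν.real B * ν.real (A ∩ C))) := by
  intro μ ν
  rw [stub_oneBondDecomp_k15 n w e (A ∩ B ∩ C), stub_oneBondDecomp_k15 n w e A, stub_oneBondDecomp_k15 n w e B,
    stub_oneBondDecomp_k15 n w e C, stub_oneBondDecomp_k15 n w e (B ∩ C), stub_oneBondDecomp_k15 n w e (A ∩ C)]
  ring

/-- A Bernstein cubic on `[0,1]` with nonnegative coefficients is nonnegative (the shape used by `c5_oneBond`). [folklore] -/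
theorem bernstein3_nonneg {p c₀ m₁ m₂ c₃ : ℝ} (hp0 : 0 ≤ p) (hp1 : p ≤ 1) (h0 : 0 ≤ c₀) (h1 : 0 ≤ m₁) (h2 : 0 ≤ m₂) (h3 : 0 ≤ c₃) :
    0 ≤ (1 - p) ^ 3 * c₀ + p * (1 - p) ^ 2 * m₁ + p ^ 2 * (1 - p) * m₂ + p ^ 3 * c₃ := by
  have hq : 0 ≤ 1 - p := by linarith
  positivity

/-- **`C5 ≥ 0` from the four Bernstein coefficients along one pair.**  If the form is nonnegative under `w[e↦0]` and `w[e↦1]` and both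
mixed coefficients of `c5_oneBond` are nonnegative, then `C5 ≥ 0` under `prodBernoulli w`. [this work] -/
theorem c5_nonneg_of_bernstein (w : Sym2 (Fin n) → unitInterval) (e : Sym2 (Fin n)) (A B C : Set (BondConfig (Fin n)))
    (h0 : let μ := prodBernoulli (Function.update w e 0)
      0 ≤ 2 * μ.real (A ∩ B ∩ C) + μ.real A * μ.real B * μ.real C - μ.real A * μ.real (B ∩ C) - 2 * (μ.real B * μ.real (A ∩ C)))
    (h1 : let μ := prodBernoulli (Function.update w e 0); let ν := prodBernoulli (Function.update w e 1)
      0 ≤ 2 * (ν.real (A ∩ B ∩ C) + 2 * μ.real (A ∩ B ∩ C))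
            + (ν.real A * μ.real B * μ.real C + μ.real A * ν.real B * μ.real C + μ.real A * μ.real B * ν.real C)
            - (ν.real A * μ.real (B ∩ C) + μ.real A * ν.real (B ∩ C) + μ.real A * μ.real (B ∩ C))
            - 2 * (ν.real B * μ.real (A ∩ C) + μ.real B * ν.real (A ∩ C) + μ.real B * μ.real (A ∩ C)))
    (h2 : let μ := prodBernoulli (Function.update w e 0); let ν := prodBernoulli (Function.update w e 1)
      0 ≤ 2 * (μ.real (A ∩ B ∩ C) + 2 * ν.real (A ∩ B ∩ C))
            + (μ.real A * ν.real B * ν.real C + ν.real A * μ.real B * ν.real C + ν.real A * ν.real B * μ.real C)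
            - (μ.real A * ν.real (B ∩ C) + ν.real A * μ.real (B ∩ C) + ν.real A * ν.real (B ∩ C))
            - 2 * (μ.real B * ν.real (A ∩ C) + ν.real B * μ.real (A ∩ C) + ν.real B * ν.real (A ∩ C)))
    (h3 : let ν := prodBernoulli (Function.update w e 1)
      0 ≤ 2 * ν.real (A ∩ B ∩ C) + ν.real A * ν.real B * ν.real C - ν.real A * ν.real (B ∩ C) - 2 * (ν.real B * ν.real (A ∩ C))) :
    0 ≤ 2 * (prodBernoulli w).real (A ∩ B ∩ C) + (prodBernoulli w).real A * (prodBernoulli w).real B * (prodBernoulli w).real C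
        - (prodBernoulli w).real A * (prodBernoulli w).real (B ∩ C) - 2 * ((prodBernoulli w).real B * (prodBernoulli w).real (A ∩ C)) := by
  rw [c5_oneBond w e A B C]
  exact bernstein3_nonneg (w e).2.1 (w e).2.2 h0 h1 h2 h3

end IncStar

end Summit.CriticalPhenomena.PercolationContinuityZ3.Theorems
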